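import Summits.PneNP.PneNP.Theorems.RamseyUncertifiableResolutionUncertaintyHeavyBlockWidth

/-!
# The Prover–Delayer walk down a resolution refutation — item stmt-PneNP-9816
# `RamseyUncertifiable.ResolutionUncertainty` (support), infrastructure for the TREE-LIKE rung

Generic machinery over the tree's resolution system (`IsResDerivation`, `ResLine`, `ResRule`): given a derivation
`π`, a start line `r` and an ANSWERING RULE `ans` (a Delayer: record ↦ queried variable ↦ value), the walk
`TreeLike.run π ans r s` keeps a state `(line, record)`; at a weakening it moves to the premise, at a resolution step
on `v` it uses the recorded value of `v` or else asks `ans`, records the value, and moves to the premise containing the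
literal this value falsifies; at an initial line it halts. Proved here: the walk stays in `π`, line indices strictly
decrease until it halts, it has halted after `π.length` steps (`step_run_length`) and then sits on an initial line
(`final_mem`); records only grow (`run_snd_mono`); and if the start clause is empty the record falsifies the current
clause throughout (`run_falsifies`). Summary: `walk_halts_falsified`. Used by
`RamseyUncertifiableResolutionUncertaintyTreeLike.lean` (tree-like refutations of `Clique(G,k)` enumerate cliques).
[folklore Prover–Delayer / decision-tree reading of resolution refutations]
-/

set_option linter.dupNamespace false

namespace Summit.PneNP.PneNP.Theorems.RamseyUncertifiableResolutionUncertainty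

open Literature.Computability.Complexity Literature.Computability.MetaComplexity

namespace TreeLike

/-! ## The walk -/
/-- The value used for the pivot `v` at record `ρ`: the recorded one if any, else the answer. -/
noncomputable def pivotVal (ans : (ℕ → Option Bool) → ℕ → Bool) (ρ : ℕ → Option Bool) (v : ℕ) : Bool :=
  (ρ v).getD (ans ρ v)

/-- One step of the walk on `π` with answering rule `ans`, from the state `(line, record)`, given the rule of the
current line: identity at an initial line; to the premise at a weakening; at a resolution step on `v`, record
`pivotVal` for `v` and move to the premise containing the literal it falsifies. -/
noncomputable def stepRule (ans : (ℕ → Option Bool) → ℕ → Bool) (st : ℕ × (ℕ → Option Bool)) :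
    ResRule ℕ → ℕ × (ℕ → Option Bool)
  | .initial => st
  | .weaken i => (i, st.2)
  | .resolve i j v =>
      (if pivotVal ans st.2 v then j else i, fun w => if w = v then some (pivotVal ans st.2 v) else st.2 w)

/-- One step of the walk (identity out of range). -/
noncomputable def step (π : List (ResLine ℕ)) (ans : (ℕ → Option Bool) → ℕ → Bool)
    (st : ℕ × (ℕ → Option Bool)) : ℕ × (ℕ → Option Bool) :=
  if h : st.1 < π.length then stepRule ans st (π[st.1]'h).rule else st

/-- The walk after `s` steps, started at line `r` with the empty record. -/
noncomputable def run (π : List (ResLine ℕ)) (ans : (ℕ → Option Bool) → ℕ → Bool) (r : ℕ) :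
    ℕ → ℕ × (ℕ → Option Bool)
  | 0 => (r, fun _ => none)
  | s + 1 => step π ans (run π ans r s)

section Walk

variable {φ : CNF ℕ} {π : List (ResLine ℕ)} (ans : (ℕ → Option Bool) → ℕ → Bool) {r : ℕ}

/-- Unfolding one step of the walk. -/
theorem run_succ (s : ℕ) : run π ans r (s + 1) = step π ans (run π ans r s) := rfl

/-- A step keeps the state or moves to a premise of the current line (hence to a smaller index). -/
theorem step_fst (hπ : IsResDerivation φ π) (st : ℕ × (ℕ → Option Bool)) (hst : st.1 < π.length) :
    step π ans st = st ∨ ((step π ans st).1 ∈ (π[st.1]'hst).premises ∧ (step π ans st).1 < st.1) := by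
  have hv := hπ st.1 hst
  have hlen : (π.take st.1).length = st.1 := by simp [hst.le]
  unfold IsValidResLine at hv
  unfold step
  rw [dif_pos hst]
  rcases hrule : (π[st.1]'hst).rule with _ | ⟨i, j, v⟩ | ⟨i⟩
  · exact Or.inl rfl
  · rw [hrule] at hv
    obtain ⟨hi, hj, -⟩ := hv
    rw [hlen] at hi hj
    right
    simp only [stepRule, ResLine.premises, hrule, ResRule.premises]
    constructor
    · split <;> simp
    · split <;> omega
  · rw [hrule] at hv
    obtain ⟨hi, -⟩ := hv
    rw [hlen] at hi
    right
    simp only [stepRule, ResLine.premises, hrule, ResRule.premises]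
    exact ⟨by simp, hi⟩

/-- The walk stays inside `π`. -/
theorem run_fst_lt (hπ : IsResDerivation φ π) (hr : r < π.length) (s : ℕ) : (run π ans r s).1 < π.length := by
  induction s with
  | zero => simpa [run] using hr
  | succ s ih =>
    rw [run_succ]
    rcases step_fst ans hπ (run π ans r s) ih with h | ⟨-, h⟩
    · rw [h]; exact ih
    · exact lt_trans h ih

/-- Lines do not increase along the walk. -/
theorem run_fst_succ_le (hπ : IsResDerivation φ π) (hr : r < π.length) (s : ℕ) :
    (run π ans r (s + 1)).1 ≤ (run π ans r s).1 := by
  rw [run_succ]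
  rcases step_fst ans hπ (run π ans r s) (run_fst_lt ans hπ hr s) with h | ⟨-, h⟩
  · rw [h]
  · exact h.le

/-- Lines do not increase along the walk (several steps). -/
theorem run_fst_mono (hπ : IsResDerivation φ π) (hr : r < π.length) (s d : ℕ) :
    (run π ans r (s + d)).1 ≤ (run π ans r s).1 := by
  induction d with
  | zero => exact le_rfl
  | succ d ih => exact (run_fst_succ_le ans hπ hr (s + d)).trans ih

/-- If the line is the same at two times, so is the whole state (the walk only pauses at fixed points). -/
theorem run_eq_of_fst_eq (hπ : IsResDerivation φ π) (hr : r < π.length) (s d : ℕ)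
    (heq : (run π ans r s).1 = (run π ans r (s + d)).1) : run π ans r s = run π ans r (s + d) := by
  induction d with
  | zero => rfl
  | succ d ih =>
    have h1 : (run π ans r (s + d)).1 ≤ (run π ans r s).1 := run_fst_mono ans hπ hr s d
    have h2 : (run π ans r (s + d + 1)).1 ≤ (run π ans r (s + d)).1 := run_fst_succ_le ans hπ hr (s + d)
    have h3 : (run π ans r (s + (d + 1))).1 = (run π ans r (s + d + 1)).1 := rfl
    have ih' := ih (by omega)
    rcases step_fst ans hπ (run π ans r (s + d)) (run_fst_lt ans hπ hr (s + d)) with h | ⟨-, h⟩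
    · rw [ih']
      show run π ans r (s + d) = step π ans (run π ans r (s + d))
      exact h.symm
    · exfalso
      rw [← run_succ] at h
      omega

/-- After `π.length` steps the walk has halted (it sits at a fixed point of `step`). -/
theorem step_run_length (hπ : IsResDerivation φ π) (hr : r < π.length) :
    step π ans (run π ans r π.length) = run π ans r π.length := by
  by_contra hne
  -- if the walk has not halted at time `π.length`, it never paused before, so the line dropped at every step
  have hdrop : ∀ s ≤ π.length, (run π ans r s).1 + s ≤ r := by
    intro s hs
    induction s with
    | zero => simp [run]
    | succ s ih =>
      have ih := ih (by omega)
      rcases step_fst ans hπ (run π ans r s) (run_fst_lt ans hπ hr s) with h | ⟨-, h⟩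
      · -- a pause at time `s` propagates to time `π.length`
        exfalso
        obtain ⟨d, hd⟩ := Nat.exists_eq_add_of_le (by omega : s ≤ π.length)
        have hfix : run π ans r (s + 1) = run π ans r s := h
        have hconst : ∀ e, run π ans r (s + e) = run π ans r s := by
          intro e
          induction e with
          | zero => rfl
          | succ e ihe =>
            show step π ans (run π ans r (s + e)) = run π ans r s
            rw [ihe]
            exact h
        apply hne
        rw [hd, hconst d]
        exact h
      · rw [← run_succ] at h
        omega
  have := hdrop π.length le_rfl
  omega

/-- A fixed point of `step` inside `π` is an initial line: its clause is a clause of `φ`. -/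
theorem mem_of_step_eq (hπ : IsResDerivation φ π) (st : ℕ × (ℕ → Option Bool)) (hlt : st.1 < π.length)
    (hfix : step π ans st = st) : (π[st.1]'hlt).clause ∈ φ.clauseFinsets := by
  have hv := hπ st.1 hlt
  have hlen : (π.take st.1).length = st.1 := by simp [hlt.le]
  unfold IsValidResLine at hv
  unfold step at hfix
  rw [dif_pos hlt] at hfix
  rcases hrule : (π[st.1]'hlt).rule with _ | ⟨i, j, v⟩ | ⟨i⟩
  · rw [hrule] at hv
    exact hv
  · rw [hrule] at hv hfix
    obtain ⟨hi, hj, -⟩ := hv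
    rw [hlen] at hi hj
    exfalso
    have h1 := congrArg Prod.fst hfix
    simp only [stepRule] at h1
    split at h1 <;> omega
  · rw [hrule] at hv hfix
    obtain ⟨hi, -⟩ := hv
    rw [hlen] at hi
    exfalso
    have h1 := congrArg Prod.fst hfix
    simp only [stepRule] at h1
    omega

/-- The halting line is an initial line: its clause is a clause of `φ`. -/
theorem final_mem (hπ : IsResDerivation φ π) (hr : r < π.length) :
    (π[(run π ans r π.length).1]'(run_fst_lt ans hπ hr _)).clause ∈ φ.clauseFinsets :=
  mem_of_step_eq ans hπ _ _ (step_run_length ans hπ hr)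

/-- Records only grow along one step. -/
theorem step_snd_mono (st : ℕ × (ℕ → Option Bool)) {w : ℕ} {b : Bool} (h : st.2 w = some b) :
    (step π ans st).2 w = some b := by
  unfold step
  split_ifs with hlt
  · rcases (π[st.1]'hlt).rule with _ | ⟨i, j, v⟩ | ⟨i⟩
    · exact h
    · simp only [stepRule]
      split_ifs with hw
      · subst hw
        simp [pivotVal, h]
      · exact h
    · exact h
  · exact h

/-- Records only grow along the walk. -/
theorem run_snd_mono (s d : ℕ) {w : ℕ} {b : Bool} (h : (run π ans r s).2 w = some b) :
    (run π ans r (s + d)).2 w = some b := by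
  induction d with
  | zero => exact h
  | succ d ih => exact step_snd_mono ans _ ih

/-- One step preserves "the record falsifies the current clause". -/
theorem step_falsifies (hπ : IsResDerivation φ π) (st : ℕ × (ℕ → Option Bool)) (hst : st.1 < π.length)
    (hf : ∀ l ∈ (π[st.1]'hst).clause, st.2 l.1 = some (!l.2))
    {c' : ℕ} {ρ' : ℕ → Option Bool} (hc' : (step π ans st).1 = c') (hρ' : (step π ans st).2 = ρ')
    (hlt' : c' < π.length) :
    ∀ l ∈ (π[c']'hlt').clause, ρ' l.1 = some (!l.2) := by
  have hv := hπ st.1 hst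
  have hlen : (π.take st.1).length = st.1 := by simp [hst.le]
  unfold IsValidResLine at hv
  unfold step at hc' hρ'
  rw [dif_pos hst] at hc' hρ'
  rcases hrule : (π[st.1]'hst).rule with _ | ⟨i, j, v⟩ | ⟨i⟩
  · rw [hrule] at hc' hρ'
    simp only [stepRule] at hc' hρ'
    subst hc' hρ'
    exact hf
  · rw [hrule] at hv hc' hρ'
    obtain ⟨hi, hj, hres⟩ := hv
    rw [List.getElem_take, List.getElem_take] at hres
    obtain ⟨hC, hD, hE⟩ := hres
    -- a recorded value of `v` agrees with `pivotVal`
    have hbv : ∀ b', st.2 v = some b' → pivotVal ans st.2 v = b' := by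
      intro b' h'
      simp [pivotVal, h']
    -- a literal of the old clause on the pivot variable has the value opposite to `pivotVal`
    have hold : ∀ l', l' ∈ (π[st.1]'hst).clause → l'.1 = v → l'.2 = !(pivotVal ans st.2 v) := by
      intro l' hl' h1
      have h2 := hf l' hl'
      rw [h1] at h2
      rw [hbv _ h2, Bool.not_not]
    simp only [stepRule] at hc' hρ'
    clear hbv
    generalize hb : pivotVal ans st.2 v = b at hold hc' hρ'
    subst hρ'
    intro l hl
    beta_reduce
    cases b
    · -- moved to premise `i`, whose clause `C ∋ (v, true)`
      simp only [Bool.false_eq_true, ↓reduceIte] at hc'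
      subst hc'
      by_cases hlv : l.1 = v
      · rw [if_pos hlv]
        by_cases hl' : l = (v, true)
        · rw [hl']
          rfl
        · have hlE : l ∈ (π[st.1]'hst).clause := by
            rw [hE]; exact Finset.mem_union_left _ (Finset.mem_erase.2 ⟨hl', hl⟩)
          have h2 := hold l hlE hlv
          exfalso
          apply hl'
          ext
          · exact hlv
          · exact h2
      · rw [if_neg hlv]
        have hl' : l ≠ (v, true) := fun h => hlv (by rw [h])
        have hlE : l ∈ (π[st.1]'hst).clause := by
          rw [hE]; exact Finset.mem_union_left _ (Finset.mem_erase.2 ⟨hl', hl⟩)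
        exact hf l hlE
    · simp only [↓reduceIte] at hc'
      subst hc'
      by_cases hlv : l.1 = v
      · rw [if_pos hlv]
        by_cases hl' : l = (v, false)
        · rw [hl']
          rfl
        · have hlE : l ∈ (π[st.1]'hst).clause := by
            rw [hE]; exact Finset.mem_union_right _ (Finset.mem_erase.2 ⟨hl', hl⟩)
          have h2 := hold l hlE hlv
          exfalso
          apply hl'
          ext
          · exact hlv
          · exact h2
      · rw [if_neg hlv]
        have hl' : l ≠ (v, false) := fun h => hlv (by rw [h])
        have hlE : l ∈ (π[st.1]'hst).clause := by
          rw [hE]; exact Finset.mem_union_right _ (Finset.mem_erase.2 ⟨hl', hl⟩)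
        exact hf l hlE
  · rw [hrule] at hv hc' hρ'
    obtain ⟨hi, hsub⟩ := hv
    rw [List.getElem_take] at hsub
    simp only [stepRule] at hc' hρ'
    subst hc' hρ'
    intro l hl
    exact hf l (hsub hl)

/-- The record falsifies the current clause (every literal is recorded with the opposite value). -/
theorem run_falsifies (hπ : IsResDerivation φ π) (hr : r < π.length) (hroot : (π[r]'hr).clause = ∅) (s : ℕ) :
    ∀ l ∈ (π[(run π ans r s).1]'(run_fst_lt ans hπ hr s)).clause, (run π ans r s).2 l.1 = some (!l.2) := by
  induction s with
  | zero =>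
    intro l hl
    simp only [run] at hl
    rw [hroot] at hl
    simp at hl
  | succ s ih =>
    exact step_falsifies ans hπ (run π ans r s) (run_fst_lt ans hπ hr s) ih rfl rfl (run_fst_lt ans hπ hr (s + 1))

end Walk

/-! ## Tree-likeness: one consumer per line -/

section Tree

variable {π : List (ResLine ℕ)}

/-- In a tree-like derivation a line is a premise of at most one line. -/
theorem consumer_unique (htree : IsTreeLike π) {c p p' : ℕ} (hp : p < π.length) (hp' : p' < π.length)
    (hc : c ∈ (π[p]'hp).premises) (hc' : c ∈ (π[p']'hp').premises) : p = p' := by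
  by_contra hne
  have key : ∀ {a b : ℕ} (ha : a < π.length) (hb : b < π.length), a < b →
      c ∈ (π[a]'ha).premises → c ∈ (π[b]'hb).premises → False := by
    intro a b ha hb hab hca hcb
    have hsum := htree c
    have hsplit : (π.map fun l => l.premises.count c).sum =
        ((π.take b).map fun l => l.premises.count c).sum + ((π.drop b).map fun l => l.premises.count c).sum := by
      rw [← List.sum_append, ← List.map_append, List.take_append_drop]
    have h1 : 1 ≤ ((π.take b).map fun l => l.premises.count c).sum := by
      have hmem : (π[a]'ha).premises.count c ∈ (π.take b).map fun l => l.premises.count c :=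
        List.mem_map.2 ⟨π[a]'ha, List.mem_take_iff_getElem.2 ⟨a, by simp [hab, ha], by simp⟩, rfl⟩
      exact le_trans (List.count_pos_iff.2 hca) (List.le_sum_of_mem hmem)
    have h2 : 1 ≤ ((π.drop b).map fun l => l.premises.count c).sum := by
      have hmem : (π[b]'hb).premises.count c ∈ (π.drop b).map fun l => l.premises.count c := by
        refine List.mem_map.2 ⟨π[b]'hb, ?_, rfl⟩
        rw [List.mem_iff_getElem]
        exact ⟨0, by simp; omega, by simp⟩
      exact le_trans (List.count_pos_iff.2 hcb) (List.le_sum_of_mem hmem)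
    omega
  rcases lt_or_gt_of_ne hne with h | h
  · exact key hp hp' h hc hc'
  · exact key hp' hp h hc' hc

/-- In a tree-like derivation the two premises of a resolution line are distinct lines. -/
theorem premises_ne (htree : IsTreeLike π) {p i j v : ℕ} (hp : p < π.length)
    (hrule : (π[p]'hp).rule = .resolve i j v) : i ≠ j := by
  intro hij
  subst hij
  have hsum := htree i
  have hmem : (π[p]'hp).premises.count i ∈ π.map fun l => l.premises.count i :=
    List.mem_map.2 ⟨π[p]'hp, List.getElem_mem hp, rfl⟩
  have h2 : (π[p]'hp).premises.count i = 2 := by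
    simp [ResLine.premises, hrule, ResRule.premises]
  have := List.le_sum_of_mem hmem
  omega


end Tree

end TreeLike

/-- **The walk halts on a falsified axiom** (summary of this file). For every derivation `π` from `φ`, every
answering rule and every start line `r` carrying the empty clause, after `π.length` steps the walk sits on an initial
line whose clause — a clause of `φ` — is falsified by the record (each literal recorded with the opposite value). -/
theorem walk_halts_falsified :
    ∀ (φ : CNF ℕ) (π : List (ResLine ℕ)) (ans : (ℕ → Option Bool) → ℕ → Bool) (r : ℕ) (hr : r < π.length),
      IsResDerivation φ π → (π[r]'hr).clause = ∅ →
        ∃ c ∈ φ, ∀ l ∈ c.toFinset, (TreeLike.run π ans r π.length).2 l.1 = some (!l.2) := by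
  intro φ π ans r hr hπ hroot
  obtain ⟨c, hc, hceq⟩ := List.mem_map.1 (TreeLike.final_mem ans hπ hr)
  refine ⟨c, hc, ?_⟩
  rw [hceq]
  exact TreeLike.run_falsifies ans hπ hr hroot π.length

end Summit.PneNP.PneNP.Theorems.RamseyUncertifiableResolutionUncertainty
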